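import Summits.KontsevichZagierPeriods.KontsevichZagierPeriods.Theorems.HurwitzMicroSectorsNormalFormPrincipleL2W3Carriers
import Summits.KontsevichZagierPeriods.KontsevichZagierPeriods.Theorems.HurwitzMicroSectorsNormalFormPrincipleM3EbdBoxSubSimplex
import Summits.KontsevichZagierPeriods.KontsevichZagierPeriods.Theorems.HurwitzMicroSectorsNormalFormPrincipleL2W3RelationsDilation
import Summits.KontsevichZagierPeriods.KontsevichZagierPeriods.Theorems.HurwitzMicroSectorsNormalFormPrincipleL2W3RelationsMoebiusOne
import Summits.KontsevichZagierPeriods.KontsevichZagierPeriods.Theorems.HurwitzMicroSectorsNormalFormPrincipleL2W3RelationsReflection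

/-!
# `NormalFormPrinciple` (stmt-KontsevichZagierPeriods-3869), line `SketchIdeator1` —
# M3 words-kernel capstone: the word reductions `aab`, `abb`, `aac`, `acc`

Pure proof file (registered sub-goal `m3x_reduce_words_1` of the extended M3 kernel capstone, lead
seat c9; `--supports` the crux). The extended capstone reduces every generator — the eleven
dimension-three box families, the log-cube box and the sixteen word families
`[Δ, x(t₀)y(t₁)z(t₂)]` of the level-2 weight-3 descent — after multiplication by `24`, to
`α•[Z] + β•[Q] + γ•[B3]` modulo `KZ.relations`, where `Z` is any representation of
`[(0,1)³, 1/(1−xyz)]` (value `ζ(3)`), `Q` any representation of `[(0,1)³, 1/((1−xy)(1+z))]`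
(value `ζ(2)·log 2`) and `B3` any representation of `[(0,1)³, 1/((1+x)(1+y)(1+z))]`
(value `(log 2)³`). This file supplies the first package of four word reductions, for the words
(letters `a(u) = 1/u`, `b(u) = 1/(1−u)`, `c(u) = 1/(1+u)` on the decreasing open simplex
`Δ = {1 > t₀ > t₁ > t₂ > 0}`)

  `aab ↦ (24, 0, 0)`, `abb ↦ (24, 0, 0)`, `aac ↦ (18, 0, 0)`, `acc ↦ (3, 0, 0)`.

Chain of moves: a given word representation `W` agrees with the landed carrier of the same word
on `Δ` (congruence); the simplex chart `(x, xy, xyz)` gives `[Z] = [aab]` (rule (2)); and the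
integer certificates over the landed relation packages (dilation `rel1 = 3[aab] − 4[aac]`,
`rel2 = [abb] − 2[abc] − 2[acb] + 2[acc]`; Möbius `rel3 = [cbb] + [cbc] + [ccb] + [ccc] − [aac]`,
`rel4 = [abb] + [abc] + [acb] + [acc] − [cbb] − [cbc] − [ccb] − [ccc] − [aab]`; reflection
`rel5 = [abb] − [aab]`)

  `24[aab] − 24[aab] = 0`,  `24[abb] − 24[aab] = 24·rel5`,  `24[aac] − 18[aab] = −6·rel1`,
  `24[acc] − 3[aab] = −3·rel1 + 6·rel2 + 12·rel3 + 12·rel4 − 18·rel5`.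

Bookkeeping only; no independence input. References: M. Kontsevich, D. Zagier, *Periods* (2001),
§1.1–1.2 (rules (1), (2)). No definitions are introduced.
-/

noncomputable section

open MeasureTheory Set
open Literature.NumberTheory.Transcendental Literature.NumberTheory.Transcendental.KZ

namespace Summit.KontsevichZagierPeriods.HurwitzMicroSectors.NormalFormPrinciple.PiBox.M3

/-- **Stub (`m3x_reduce_words_1`; registered sub-goal of stmt-KontsevichZagierPeriods-3869,
line `SketchIdeator1`, layer `M3` words-kernel capstone).** For any box representations `Z` of
`1/(1−xyz)`, `Q` of `1/((1−xy)(1+z))` and `B3` of `1/((1+x)(1+y)(1+z))`, the four word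
reductions with multiplier `24`: for every representation `W` on the decreasing open simplex of
the word `aab` (resp. `abb`, `aac`, `acc`), `24•[W] − (α•[Z] + β•[Q] + γ•[B3]) ∈ KZ.relations`
with `(α, β, γ) = (24, 0, 0)` (resp. `(24, 0, 0)`, `(18, 0, 0)`, `(3, 0, 0)`), obtained inside the
calculus: congruence with the landed word carrier, the simplex chart `[Z] = [aab]`, and the integer
certificates `0`, `24·rel5`, `−6·rel1`, `−3·rel1 + 6·rel2 + 12·rel3 + 12·rel4 − 18·rel5` over the
landed dilation / Möbius / reflection relation packages.
[cite: KontsevichZagier2001, §1.2 rules (1), (2)] -/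
theorem m3x_reduce_words_1 :
    ∀ (Z Q B3 : IntegralRep 3),
      Z.domain = {x | ∀ i, x i ∈ Set.Ioo (0:ℝ) 1} → (Z.integrand = fun x => 1 / (1 - x 0 * x 1 * x 2)) →
      Q.domain = {x | ∀ i, x i ∈ Set.Ioo (0:ℝ) 1} → EqOn Q.integrand (fun x => 1 / ((1 - x 0 * x 1) * (1 + x 2))) Q.domain →
      B3.domain = {x | ∀ i, x i ∈ Set.Ioo (0:ℝ) 1} → (B3.integrand = fun x => 1 / ((1 + x 0) * (1 + x 1) * (1 + x 2))) →
        (∀ W : IntegralRep 3, W.domain = {t | 0 < t 2 ∧ t 2 < t 1 ∧ t 1 < t 0 ∧ t 0 < 1} →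
          EqOn W.integrand (fun t => 1 / t 0 * 1 / t 1 * (1 / (1 - t 2))) W.domain →
          (24:ℕ) • of W - ((24:ℤ) • of Z + (0:ℤ) • of Q + (0:ℤ) • of B3) ∈ relations) ∧
        (∀ W : IntegralRep 3, W.domain = {t | 0 < t 2 ∧ t 2 < t 1 ∧ t 1 < t 0 ∧ t 0 < 1} →
          EqOn W.integrand (fun t => 1 / t 0 * (1 / (1 - t 1)) * (1 / (1 - t 2))) W.domain →
          (24:ℕ) • of W - ((24:ℤ) • of Z + (0:ℤ) • of Q + (0:ℤ) • of B3) ∈ relations) ∧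
        (∀ W : IntegralRep 3, W.domain = {t | 0 < t 2 ∧ t 2 < t 1 ∧ t 1 < t 0 ∧ t 0 < 1} →
          EqOn W.integrand (fun t => 1 / t 0 * 1 / t 1 * (1 / (1 + t 2))) W.domain →
          (24:ℕ) • of W - ((18:ℤ) • of Z + (0:ℤ) • of Q + (0:ℤ) • of B3) ∈ relations) ∧
        (∀ W : IntegralRep 3, W.domain = {t | 0 < t 2 ∧ t 2 < t 1 ∧ t 1 < t 0 ∧ t 0 < 1} →
          EqOn W.integrand (fun t => 1 / t 0 * (1 / (1 + t 1)) * (1 / (1 + t 2))) W.domain →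
          (24:ℕ) • of W - ((3:ℤ) • of Z + (0:ℤ) • of Q + (0:ℤ) • of B3) ∈ relations) := by
  intro Z Q B3 hZd hZi _ _ _ _
  -- (1) the word carriers on `Δ` (only the ten `a/b/c`-words entering `rel1`–`rel5` are kept)
  obtain ⟨AAB, ABB, AAC, ACC, ABC, ACB, CBB, CBC, CCB, CCC, -, -, -, -, -, -,
    ⟨hAABd, hAABi⟩, ⟨hABBd, hABBi⟩, ⟨hAACd, hAACi⟩, ⟨hACCd, hACCi⟩, ⟨hABCd, hABCi⟩,
    ⟨hACBd, hACBi⟩, ⟨hCBBd, hCBBi⟩, ⟨hCBCd, hCBCi⟩, ⟨hCCBd, hCCBi⟩, ⟨hCCCd, hCCCi⟩,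
    -, -, -, -, -, -⟩ := l2w3_carriers
  -- (2) `[Z] = [aab]` by the simplex chart: `1/(1−xyz) = a(x)·a(xy)·b(xyz)·(x²y)`
  have eZ : of Z - of AAB ∈ relations := by
    refine ebd_box_sub_simplex (fun t => 1 / t 0 * 1 / t 1 * (1 / (1 - t 2))) Z AAB hZd hAABd
      (hAABi ▸ fun _ _ => rfl) fun x hx => ?_
    have hx' : ∀ i, x i ∈ Set.Ioo (0:ℝ) 1 := by rw [hZd] at hx; exact hx
    have h0 : x 0 ≠ 0 := (hx' 0).1.ne'
    have h1 : x 1 ≠ 0 := (hx' 1).1.ne'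
    have h012m : 1 - x 0 * x 1 * x 2 ≠ 0 := by
      have := mul_lt_one_of_nonneg_of_lt_one_left (mul_pos (hx' 0).1 (hx' 1).1).le
        (mul_lt_one_of_nonneg_of_lt_one_left (hx' 0).1.le (hx' 0).2 (hx' 1).2.le) (hx' 2).2.le
      exact (sub_pos.2 this).ne'
    rw [hZi]
    simp only [Matrix.cons_val_zero, Matrix.cons_val_one, Matrix.cons_val_two, Matrix.head_cons,
      Matrix.tail_cons]
    field_simp
  -- (3) the landed relation packages
  have rel1 : (3:ℤ) • of AAB - (4:ℤ) • of AAC ∈ relations :=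
    l2w3_relations_dilation.1 AAB hAABd hAABi AAC hAACd hAACi
  have rel2 : of ABB - (2:ℤ) • of ABC - (2:ℤ) • of ACB + (2:ℤ) • of ACC ∈ relations :=
    l2w3_relations_dilation.2 ABB hABBd hABBi ABC hABCd hABCi ACB hACBd hACBi ACC hACCd hACCi
  have rel3 : of CBB + of CBC + of CCB + of CCC - of AAC ∈ relations :=
    l2w3_relations_moebius_one.1 AAC hAACd hAACi CBB hCBBd hCBBi CBC hCBCd hCBCi CCB hCCBd hCCBi
      CCC hCCCd hCCCi
  have rel4 : of ABB + of ABC + of ACB + of ACC - of CBB - of CBC - of CCB - of CCC - of AAB ∈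
      relations :=
    l2w3_relations_moebius_one.2 AAB hAABd hAABi ABB hABBd hABBi ABC hABCd hABCi ACB hACBd hACBi
      ACC hACCd hACCi CBB hCBBd hCBBi CBC hCBCd hCBCi CCB hCCBd hCCBi CCC hCCCd hCCCi
  have rel5 : of ABB - of AAB ∈ relations :=
    l2w3_relations_reflection.1 AAB hAABd hAABi ABB hABBd hABBi
  refine ⟨?_, ?_, ?_, ?_⟩
  · -- the word `aab` (value `ζ(3)`): `24[aab] − 24[aab] = 0`
    intro W hWd hWi
    have hW : of W - of AAB ∈ relations :=
      of_sub_of_mem_relations_of_eqOn (hAABd.trans hWd.symm) fun t ht => by rw [hWi ht, hAABi]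
    simp only [zero_smul, add_zero]
    have e : (24:ℕ) • of W - (24:ℤ) • of Z = (24:ℤ) • (of W - of AAB) - (24:ℤ) • (of Z - of AAB) := by
      abel
    rw [e]
    exact relations.sub_mem (relations.zsmul_mem hW 24) (relations.zsmul_mem eZ 24)
  · -- the word `abb` (value `ζ(3)`): `24[abb] − 24[aab] = 24·rel5`
    intro W hWd hWi
    have hW : of W - of ABB ∈ relations :=
      of_sub_of_mem_relations_of_eqOn (hABBd.trans hWd.symm) fun t ht => by rw [hWi ht, hABBi]
    simp only [zero_smul, add_zero]
    have e : (24:ℕ) • of W - (24:ℤ) • of Z =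
        (24:ℤ) • (of W - of ABB) + (24:ℤ) • (of ABB - of AAB) - (24:ℤ) • (of Z - of AAB) := by
      abel
    rw [e]
    exact relations.sub_mem (relations.add_mem (relations.zsmul_mem hW 24)
      (relations.zsmul_mem rel5 24)) (relations.zsmul_mem eZ 24)
  · -- the word `aac` (value `¾ζ(3)`): `24[aac] − 18[aab] = −6·rel1`
    intro W hWd hWi
    have hW : of W - of AAC ∈ relations :=
      of_sub_of_mem_relations_of_eqOn (hAACd.trans hWd.symm) fun t ht => by rw [hWi ht, hAACi]
    simp only [zero_smul, add_zero]
    have e : (24:ℕ) • of W - (18:ℤ) • of Z =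
        (24:ℤ) • (of W - of AAC) - (6:ℤ) • ((3:ℤ) • of AAB - (4:ℤ) • of AAC)
          - (18:ℤ) • (of Z - of AAB) := by
      abel
    rw [e]
    exact relations.sub_mem (relations.sub_mem (relations.zsmul_mem hW 24)
      (relations.zsmul_mem rel1 6)) (relations.zsmul_mem eZ 18)
  · -- the word `acc` (value `⅛ζ(3)`):
    --   `24[acc] − 3[aab] = −3·rel1 + 6·rel2 + 12·rel3 + 12·rel4 − 18·rel5`
    intro W hWd hWi
    have hW : of W - of ACC ∈ relations :=
      of_sub_of_mem_relations_of_eqOn (hACCd.trans hWd.symm) fun t ht => by rw [hWi ht, hACCi]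
    have key : (24:ℤ) • of ACC - (3:ℤ) • of AAB =
        -((3:ℤ) • ((3:ℤ) • of AAB - (4:ℤ) • of AAC))
        + (6:ℤ) • (of ABB - (2:ℤ) • of ABC - (2:ℤ) • of ACB + (2:ℤ) • of ACC)
        + (12:ℤ) • (of CBB + of CBC + of CCB + of CCC - of AAC)
        + (12:ℤ) • (of ABB + of ABC + of ACB + of ACC - of CBB - of CBC - of CCB - of CCC - of AAB)
        - (18:ℤ) • (of ABB - of AAB) := by
      abel
    have hmid : (24:ℤ) • of ACC - (3:ℤ) • of AAB ∈ relations := by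
      rw [key]
      exact relations.sub_mem (relations.add_mem (relations.add_mem (relations.add_mem
        (relations.neg_mem (relations.zsmul_mem rel1 3)) (relations.zsmul_mem rel2 6))
        (relations.zsmul_mem rel3 12)) (relations.zsmul_mem rel4 12)) (relations.zsmul_mem rel5 18)
    simp only [zero_smul, add_zero]
    have e : (24:ℕ) • of W - (3:ℤ) • of Z =
        (24:ℤ) • (of W - of ACC) + ((24:ℤ) • of ACC - (3:ℤ) • of AAB)
          - (3:ℤ) • (of Z - of AAB) := by
      abel
    rw [e]
    exact relations.sub_mem (relations.add_mem (relations.zsmul_mem hW 24) hmid)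
      (relations.zsmul_mem eZ 3)

end Summit.KontsevichZagierPeriods.HurwitzMicroSectors.NormalFormPrinciple.PiBox.M3
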